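import Mathlib
import HarnessLib
import Literature.AlgebraicGeometry.Resolution.Lipman1969RationalSurfaceSingularities
import Literature.AlgebraicGeometry.Resolution.RationalSurfaceSingularitiesBasic
import Literature.AlgebraicGeometry.Resolution.ExceptionalCurvePoints
import Literature.AlgebraicGeometry.Resolution.ExceptionalPointsFinite
import Literature.AlgebraicGeometry.Resolution.AffineDomainDimension
import Literature.RingTheory.CohomologyAnnihilator.Basic
import Summits.ResolutionOfSingularities.ResolutionOfSingularities.Theorems.HomologicalConductorNoZenoExitDivisor
import Summits.ResolutionOfSingularities.ResolutionOfSingularities.Theorems.HomologicalConductorNoZenoIffKernel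
import Summits.ResolutionOfSingularities.ResolutionOfSingularities.Theorems.HomologicalConductorNoZenoClosedFibreDictionaryTower
import Summits.ResolutionOfSingularities.ResolutionOfSingularities.Theorems.HomologicalConductorSurfaceTerminationReductionDefs
import Summits.ResolutionOfSingularities.ResolutionOfSingularities.Theorems.HomologicalConductorSurfaceTerminationDescentStep
import Summits.ResolutionOfSingularities.ResolutionOfSingularities.Theorems.HomologicalConductorSurfaceTerminationCentres
import Summits.ResolutionOfSingularities.ResolutionOfSingularities.Theorems.HomologicalConductorSurfaceTerminationRationalPropagation
import Summits.ResolutionOfSingularities.ResolutionOfSingularities.Theorems.HomologicalConductorSurfaceTerminationCapturePrincipal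

/-!
# Route `HomologicalConductor`, kill test `SurfaceTermination` (stmt-ResolutionOfSingularities-16488):
# **RATIONAL STAGES TERMINATE** — K44S-DESCENT (R2) PROVED modulo the six named facts, by the K-internal
# E-descent (the typed (R2) mechanism of record, res-L0-w44-tri-1 TRIAGE v6.1 §23, 2026-08-27T09:27:42Z)

OURS (cell res-hironaka, crux chain W4.4; composition res-L0-w44-stub-4, bricks res-L0-w44-stub-1 (h1 rational
propagation p518168, h3 capture-principal p519327), res-D-pv-045 (THEOREM A off the tower p517833, inside h3),
res-L0-w44-stub-4 (step lemma p517878, centre-ring dictionary p519964 / `…Centres`), and the tree's exit divisor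
(res-L0-w44-lead-1 / stub-3 sandwich line)); nothing here is a statement of the manuscript under review
(Hironaka 2017); AI-written, weaker than expert review.  SUPPORT-level work on the kill test K4.4-s (director's
kill test `SurfaceTermination`), NOT crux work (CHAIN note 48).  This is the sorry-free form of the skeleton
`DescentSketch.lean` fe8b124aa2e4b8e4 (evidence #25 on stmt-16488): every `stub_*` is now a tree theorem.

THEOREM (`rationalStageTermination`, = the sketch's `RationalStageTermination` / strat-1's line `genus-descent`
stub 3 via `rationalPrimeDivisorSurfaceTermination`).  Modulo the registered six-fact bundle of crux skeleton v22
(Cossart–Jannsen–Saito 2020 general form, Lipman 1969 (1.2), (4.1), (12.1)(i), (12.1)(ii), Görtz–Wedhorn 24.44 H²):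
for the route's datum (`k ⊆ O`, `A` finitely generated with `Frac A = K`, `A ⊆ O`, `ringKrullDim A = 2`) and
ANY valuation ring `O`, if some stage `T_(m₁+1)` of the canonical normalised `ca`-tower has a rational singularity,
then some stage is a regular local ring.

PROOF (E-descent).  Fix ONE resolution `π : X ⟶ Spec T_(m₁+1)` with `H¹ = 0` (the definition of rationality)
and its centre-ring dictionary `ctr : X → Subalgebra k K` (`CentreRing.exists_centreRing_tower`).  The measure
`E j = {V : ValuationSubring K | V ≠ K, T_j ≤ V relatively dominated, ∃ x, ctr x = V}` is finite at `j = m₁+1`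
(curve detection: such `x` are integral exceptional curve points, a finite set), antitone in `j` (stages are
`O`-dominated), and at every singular step `T_j ↦ T_(j+1)` it loses the EXIT DIVISOR `W` of the step
(`NoZeno.SandwichCluster.exists_exitDivisor`: `W` dominates `T_j`, not `T_(j+1)`): the centre ring `S_W` of `W`
contains every stage up to `T_(j+1)` — by induction on the stage, rationality propagating (h1), `ca(T_i)·S_W`
principal by capture (h3, THEOREM A at the lift of `S_W` to `X_min(T_i)`), hence `T_(i+1) ≤ S_W` by the step
lemma with `V := W` — and then `W ≤ S_W` because `W` is essentially generated by `T_(j+1)`; so `S_W = W ∈ E j`.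
Hence `#E` strictly decreases while the stages stay singular: a regular stage occurs after at most
`#E(m₁+1) + 1` steps.  No blow-up scheme, no base change of resolutions, no strict transform, no uniqueness of
centres is used; `O` is never inspected (defect and rank are irrelevant).

References: J. Lipman, Publ. Math. IHÉS 36 (1969), §§1, 4, 12 [`Lipman1969`]; O. Zariski, P. Samuel,
*Commutative Algebra* II (1960), Ch. VI §17 [`ZariskiSamuel1960`]; res-L0-w44-plan-1, K44S-DESCENT v1;
res-L0-w44-stub-1, DESC-K (OURS, 2026-08-27).
-/

noncomputable section

-- single-problem summit: the doubled namespace component `ResolutionOfSingularities` is forced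
set_option linter.dupNamespace false

namespace Summit.ResolutionOfSingularities.ResolutionOfSingularities.Theorems.SurfaceTermination.Descent

open CategoryTheory AlgebraicGeometry IsLocalRing
open Literature.AlgebraicGeometry.Resolution
open Literature.RingTheory.CohomologyAnnihilator (cohomologyAnnihilator)
open Summit.ResolutionOfSingularities.ResolutionOfSingularities.Theorems.NoZeno.Birth
open Summit.ResolutionOfSingularities.ResolutionOfSingularities.Theorems.NoZeno.SandwichCluster

variable {k K : Type} [Field k] [Field K] [Algebra k K]

/-! ## Tower helpers -/

/-- `tr.deg_k K = 2` from `ringKrullDim A = 2` (`A` finitely generated, `Frac A = K`). [folklore] -/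
theorem trdeg_eq_two_of_ringKrullDim (A : Subalgebra k K) (hA : A.FG) (hfr : IsFractionRing ↥A K)
    (hdim : ringKrullDim ↥A = 2) : Algebra.trdeg k K = 2 := by
  haveI : IsFractionRing ↥A K := hfr
  haveI : Algebra.FiniteType k ↥A := A.fg_iff_finiteType.mp hA
  obtain ⟨n, hnA, hntr⟩ := exists_ringKrullDim_eq_and_trdeg_eq k ↥A
  have hn : n = 2 := by
    have h : ((n : ℕ∞) : WithBot ℕ∞) = ((2 : ℕ∞) : WithBot ℕ∞) := by
      rw [hdim] at hnA; exact_mod_cast hnA.symm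
    exact_mod_cast (WithBot.coe_injective h : (n : ℕ∞) = 2)
  rw [trdeg_eq_trdeg_of_isFractionRing A, hntr, hn]; norm_cast

/-- A regular stage stays regular (indeed the tower is stationary from it on). [folklore] -/
theorem isRegularLocalRing_tower_of_le (O : ValuationSubring K) (A : Subalgebra k K)
    (hk : ∀ c : k, algebraMap k K c ∈ O) (hfr : IsFractionRing ↥A K) (hAO : A.toSubring ≤ O.toSubring)
    {i j : ℕ} (hij : i ≤ j) (hreg : IsRegularLocalRing ↥(tower O A i)) : IsRegularLocalRing ↥(tower O A j) := by
  induction j, hij using Nat.le_induction with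
  | base => exact hreg
  | succ j _ ih =>
    rw [tower_succ_eq_self_of_isRegularLocalRing O A hk hfr hAO j ih]
    exact ih

/-! ## The theorem -/

/-- **RATIONAL STAGES TERMINATE (K44S-DESCENT (R2); = `RationalStageTermination` of the skeleton
`DescentSketch.lean`).**  Modulo the six named facts of crux skeleton v22: for the route's datum with
`ringKrullDim A = 2` and any valuation ring `O ∋ k`, if some stage `T_(m₁+1)` of the canonical normalised
`ca`-tower along `O` has a rational singularity, then some stage is a regular local ring.  Proof: the E-descent
(module docstring). [cite: Lipman1969, Proposition (1.2) and Theorem (4.1) (pp. 199, 204); ZariskiSamuel1960, Ch. VI §17] -/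
theorem rationalStageTermination
    (hF : (CossartJannsenSaito2020General.{0} ∧ Lipman1969_1_2.{0} ∧ Lipman1969_4_1.{0} ∧
      Lipman1969_12_1_i.{0} ∧ Lipman1969_12_1_ii.{0} ∧
      Literature.AlgebraicGeometry.Morphisms.GortzWedhorn2023_24_44_H2.{0}))
    (p : ℕ) (_hp : p.Prime) (k K : Type) [Field k] [CharP k p] [Field K] [Algebra k K]
    (O : ValuationSubring K) (A : Subalgebra k K) (hk : ∀ c : k, algebraMap k K c ∈ O) (hA : A.FG)
    (hfr : IsFractionRing ↥A K) (hAO : A.toSubring ≤ O.toSubring) (hdimA : ringKrullDim ↥A = 2)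
    (m₁ : ℕ) (hrat₁ : HasRationalSingularity ↥(tower O A (m₁ + 1))) :
    ∃ m : ℕ, IsRegularLocalRing ↥(tower O A m) := by
  classical
  haveI := hfr
  have h12 : Lipman1969_1_2.{0} := hF.2.1
  have htr : Algebra.trdeg k K = 2 := trdeg_eq_two_of_ringKrullDim A hA hfr hdimA
  -- wlog the rational stage is singular
  by_cases hreg₁ : IsRegularLocalRing ↥(tower O A (m₁ + 1))
  · exact ⟨_, hreg₁⟩
  -- abbreviations and the stage package at `m₁ + 1`
  have hmono : ∀ {i j : ℕ}, i ≤ j → tower O A i ≤ tower O A j :=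
    fun hij _ hx => d2rc_mem_tower_of_le O A hij hx
  have hTO : ∀ (j : ℕ) (t : K), t ∈ tower O A j → t ∈ O :=
    fun j t ht => mem_valuationSubring_of_mem_tower O hk hAO j t ht
  -- stages are dominated by `O`: an element of `T_j` inverted in `O` is inverted in `T_j` (`T_j = loc O B`)
  have inv_mem_tower_of_inv_mem : ∀ (j : ℕ) {t : K}, t ∈ tower O A j → t⁻¹ ∈ O → t⁻¹ ∈ tower O A j := by
    intro j t ht hti
    by_cases ht0 : t = 0
    · subst ht0; rw [inv_zero]; exact (tower O A j).zero_mem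
    obtain ⟨B, hBO, hTB⟩ := exists_tower_eq_loc O A hk hAO j
    have htO : t ∈ O := hTO j t ht
    rw [hTB, loc_eq_locAt] at ht ⊢
    exact SyzygyFlattening.inv_mem_locAt O B hBO ht
      (SyzygyFlattening.valuation_eq_one_of_inv_mem O htO hti ht0)
  haveI : IsNoetherianRing ↥(tower O A (m₁ + 1)) := stub_towerNoetherian k K O A hk hA hfr hAO _
  haveI : IsLocalRing ↥(tower O A (m₁ + 1)) := by
    obtain ⟨B, hBO, hTB⟩ := exists_tower_eq_loc O A hk hAO (m₁ + 1)
    rw [hTB, loc_eq_locAt]; exact SyzygyFlattening.isLocalRing_locAt O B hBO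
  have hdimT : ringKrullDim ↥(tower O A (m₁ + 1)) = 2 :=
    ringKrullDim_tower_eq_two_of_not_isRegularLocalRing O A hk hA hfr hAO htr m₁ hreg₁
  haveI : IsIntegrallyClosed ↥(tower O A (m₁ + 1)) := d2rc_isIntegrallyClosed_tower_succ O A hk hA hfr hAO m₁
  -- ONE resolution of the rational stage, fixed for the whole descent
  obtain ⟨X, π, hπ, -⟩ := id hrat₁
  haveI : IsProper π := hπ.isProper
  have hexcfin : (excCurvePoints π).Finite :=
    (excPoints_finite π).subset (hπ.excCurvePoints_subset_excPoints hdimT)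
  -- the centre-ring dictionary
  obtain ⟨ctr, hctrT, hctrReg, hctrInt, hctrEft, hcentre, hcurve⟩ :=
    CentreRing.exists_centreRing_tower O A hk hA hfr hAO htr m₁ hreg₁ X π hπ
  -- the measure
  let E : ℕ → Set (ValuationSubring K) := fun j =>
    {V | V ≠ ⊤ ∧ (tower O A j).toSubring ≤ V.toSubring ∧
      (∀ t ∈ tower O A j, t⁻¹ ∈ V → t⁻¹ ∈ tower O A j) ∧ ∃ x, ((ctr x : Set K) = (V : Set K))}
  have hE : ∀ j V, V ∈ E j ↔ (V ≠ ⊤ ∧ (tower O A j).toSubring ≤ V.toSubring ∧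
      (∀ t ∈ tower O A j, t⁻¹ ∈ V → t⁻¹ ∈ tower O A j) ∧ ∃ x, ((ctr x : Set K) = (V : Set K))) :=
    fun j V => Iff.rfl
  -- (F1) finiteness at `m₁ + 1`
  have hfin : (E (m₁ + 1)).Finite := by
    have himg : ((fun x => ((ctr x : Subalgebra k K) : Set K)) '' excCurvePoints π).Finite :=
      hexcfin.image _
    refine (himg.preimage (Set.injOn_of_injective SetLike.coe_injective)).subset ?_
    intro V hV
    obtain ⟨hVtop, -, hVdom, x, hx⟩ := (hE _ V).mp hV
    exact ⟨x, hcurve x V hVtop hVdom hx, hx⟩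
  -- (F2) antitone
  have hanti : ∀ j, E (j + 1) ⊆ E j := by
    intro j V hV
    obtain ⟨hVtop, hTV, hVdom, hx⟩ := (hE _ V).mp hV
    refine (hE _ V).mpr ⟨hVtop, fun t ht => hTV (Subalgebra.mem_toSubring.mpr (hmono (Nat.le_succ j) ht)),
      fun t ht hti => ?_, hx⟩
    have h1 : t⁻¹ ∈ tower O A (j + 1) := hVdom t (hmono (Nat.le_succ j) ht) hti
    exact inv_mem_tower_of_inv_mem j ht (hTO _ _ h1)
  -- singular stages below a singular stage; rationality along singular stages
  have hsing_of_le : ∀ {i j : ℕ}, i ≤ j → ¬ IsRegularLocalRing ↥(tower O A j) →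
      ¬ IsRegularLocalRing ↥(tower O A i) :=
    fun hij hj hi => hj (isRegularLocalRing_tower_of_le O A hk hfr hAO hij hi)
  have hrat_of : ∀ i, m₁ + 1 ≤ i → ¬ IsRegularLocalRing ↥(tower O A i) →
      HasRationalSingularity ↥(tower O A i) := by
    intro i hi
    induction i, hi using Nat.le_induction with
    | base => exact fun _ => hrat₁
    | succ i hi ih =>
      intro hsing'
      obtain ⟨n, rfl⟩ : ∃ n, i = n + 1 := ⟨i - 1, by omega⟩
      have hsing : ¬ IsRegularLocalRing ↥(tower O A (n + 1)) := hsing_of_le (Nat.le_succ _) hsing'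
      exact RationalDescent.hasRationalSingularity_tower_succ h12 O A hk hA hfr hAO htr n hsing (ih hsing)
  -- (F3) strictness at a singular step: the exit divisor is lost
  have hstrict : ∀ j, m₁ + 1 ≤ j → ¬ IsRegularLocalRing ↥(tower O A (j + 1)) →
      ∃ W ∈ E j, W ∉ E (j + 1) := by
    intro j hj hsingj
    obtain ⟨n, rfl⟩ : ∃ n, j = n + 1 := ⟨j - 1, by omega⟩
    obtain ⟨W, hWtop, -, hTW, hgen, hdomW, ⟨t₀, ht₀, ht₀i, ht₀n⟩, -⟩ :=
      exists_exitDivisor O A hk hA hfr hAO htr n hsingj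
    have hTW' : ∀ {i : ℕ}, i ≤ n + 1 + 1 → (tower O A i).toSubring ≤ W.toSubring :=
      fun hi t ht => hTW (Subalgebra.mem_toSubring.mpr (hmono hi ht))
    refine ⟨W, (hE _ W).mpr ⟨hWtop, hTW' (Nat.le_succ _), hdomW, ?_⟩,
      fun hW => ?_⟩
    swap
    · -- `W` does not dominate `T_(j+1)`
      obtain ⟨-, -, hdom', -⟩ := (hE _ W).mp hW
      exact ht₀n (hdom' t₀ ht₀ ht₀i)
    -- the centre ring `S` of `W` on `X`
    have hdom₁ : ∀ t ∈ tower O A (m₁ + 1), t⁻¹ ∈ W → t⁻¹ ∈ tower O A (m₁ + 1) := by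
      intro t ht hti
      have h1 : t⁻¹ ∈ tower O A (n + 1) := hdomW t (hmono hj ht) hti
      exact inv_mem_tower_of_inv_mem _ ht (hTO _ _ h1)
    obtain ⟨x, hxW, hxdom⟩ := hcentre W (hTW' (by omega)) hdom₁
    refine ⟨x, ?_⟩
    -- every stage up to `T_(j+1)` lies in `S := ctr x` (capture + step lemma, induction on the stage)
    have hstages : ∀ i, m₁ + 1 ≤ i → i ≤ n + 1 + 1 → tower O A i ≤ ctr x := by
      intro i hi
      induction i, hi using Nat.le_induction with
      | base => exact fun _ => hctrT x
      | succ i hi ih =>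
        intro hi'
        have hTS : tower O A i ≤ ctr x := ih (by omega)
        obtain ⟨d, rfl⟩ : ∃ d, i = d + 1 := ⟨i - 1, by omega⟩
        have hsingi : ¬ IsRegularLocalRing ↥(tower O A (d + 1)) := hsing_of_le (by omega) hsingj
        have hrati : HasRationalSingularity ↥(tower O A (d + 1)) := hrat_of (d + 1) hi hsingi
        -- `S` dominates `T_i`
        have hdomS : ∀ t ∈ tower O A (d + 1), t⁻¹ ∈ ctr x → t⁻¹ ∈ tower O A (d + 1) := by
          intro t ht hti
          have h1 : t⁻¹ ∈ tower O A (n + 1) :=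
            hdomW t (hmono (by omega) ht) (hxW (Subalgebra.mem_toSubring.mpr hti))
          exact inv_mem_tower_of_inv_mem _ ht (hTO _ _ h1)
        -- capture: `ca(T_i)·S` is principal
        have hprinc := RationalDescent.isPrincipal_map_ca_of_isRegularLocalRing_dominating hF O A hk hA hfr
          hAO htr d hsingi hrati (ctr x) hTS hdomS
          (hctrReg x) (hctrEft x)
        -- the step lemma with `V := W`
        exact SurfaceTermination.tower_succ_le_of_isPrincipal O A (d + 1) W.toSubring (hTW' hi') (ctr x) hTS hxW
          hxdom (hctrInt x) hprinc
    have hTjS : tower O A (n + 1 + 1) ≤ ctr x := hstages (n + 1 + 1) (by omega) le_rfl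
    -- `W ≤ S` (essential generation) and `S ≤ W`
    refine Set.Subset.antisymm (fun s hs => hxW (Subalgebra.mem_toSubring.mpr hs)) ?_
    intro w hw
    obtain ⟨a, ha, s, hs, hsi, rfl⟩ := hgen w hw
    exact (ctr x).mul_mem (hTjS ha) (hxdom s (hTjS hs) hsi)
  -- (F4) the descent
  have key : ∀ (c j : ℕ), m₁ + 1 ≤ j → (E j).Finite → (E j).ncard ≤ c →
      ∃ m : ℕ, IsRegularLocalRing ↥(tower O A m) := by
    intro c
    induction c with
    | zero =>
      intro j hj hfinj hcard
      by_cases hreg : IsRegularLocalRing ↥(tower O A (j + 1))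
      · exact ⟨_, hreg⟩
      obtain ⟨W, hW, -⟩ := hstrict j hj hreg
      have h0 : E j = ∅ := (Set.ncard_eq_zero hfinj).mp (Nat.le_zero.mp hcard)
      rw [h0] at hW
      exact absurd hW (Set.notMem_empty W)
    | succ c ih =>
      intro j hj hfinj hcard
      by_cases hreg : IsRegularLocalRing ↥(tower O A (j + 1))
      · exact ⟨_, hreg⟩
      obtain ⟨W, hWj, hWj1⟩ := hstrict j hj hreg
      have hsub : E (j + 1) ⊆ E j := hanti j
      have hlt : (E (j + 1)).ncard < (E j).ncard :=
        Set.ncard_lt_ncard (Set.ssubset_iff_subset_ne.mpr ⟨hsub, fun h => hWj1 (h ▸ hWj)⟩) hfinj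
      exact ih (j + 1) (by omega) (hfinj.subset hsub) (by omega)
  exact key _ (m₁ + 1) le_rfl hfin le_rfl


/-- **Registered kill-test stub `stub_rationalStageTerminates` of line `genus-descent` (skeleton of record r3 on
stmt-ResolutionOfSingularities-16488, res-L0-w44-plan-1 / res-L0-w44-strat-1), in its registered shape**
(`Sig.stub_rationalStageTerminates` with the six-fact binder `Sig.stub_publishedSurfaceFacts` spelled out as its
conjunction): rational stages terminate.  One line over `rationalStageTermination`.
[cite: Lipman1969, Proposition (1.2) and Theorem (4.1) (pp. 199, 204)] -/
theorem stub_rationalStageTerminates :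
    (CossartJannsenSaito2020General.{0} ∧ Lipman1969_1_2.{0} ∧ Lipman1969_4_1.{0} ∧
      Lipman1969_12_1_i.{0} ∧ Lipman1969_12_1_ii.{0} ∧
      Literature.AlgebraicGeometry.Morphisms.GortzWedhorn2023_24_44_H2.{0}) →
    ∀ p : ℕ, p.Prime → ∀ (k K : Type) [Field k] [CharP k p] [Field K] [Algebra k K]
    (O : ValuationSubring K) (A : Subalgebra k K), (∀ c : k, algebraMap k K c ∈ O) → A.FG →
    IsFractionRing ↥A K → A.toSubring ≤ O.toSubring → ringKrullDim ↥A = 2 →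
    ∀ m₁ : ℕ, HasRationalSingularity ↥(tower O A (m₁ + 1)) → ∃ m : ℕ, IsRegularLocalRing ↥(tower O A m) :=
  fun hF p hp k K _ _ _ _ O A hk hA hfr hAO hdim m₁ hrat =>
    rationalStageTermination hF p hp k K O A hk hA hfr hAO hdim m₁ hrat

/-- **The rational sub-case of (D-s)** (= `RationalPrimeDivisorSurfaceTermination` of the skeleton; the text of
res-L0-w44-strat-1's line `genus-descent` stub `stub_rationalStageTerminates`): the binders of
`SurfaceTermination.Reduction.PrimeDivisorSurfaceTermination` over the named tower, plus «some stage `T_(m₁+1)`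
has a rational singularity» ⇒ some stage is regular.  The three prime-divisor binders are not used.
[cite: Lipman1969, Proposition (1.2) (p. 199)] -/
theorem rationalPrimeDivisorSurfaceTermination
    (hF : (CossartJannsenSaito2020General.{0} ∧ Lipman1969_1_2.{0} ∧ Lipman1969_4_1.{0} ∧
      Lipman1969_12_1_i.{0} ∧ Lipman1969_12_1_ii.{0} ∧
      Literature.AlgebraicGeometry.Morphisms.GortzWedhorn2023_24_44_H2.{0})) :
    ∀ p : ℕ, p.Prime → ∀ (k K : Type) [Field k] [CharP k p] [Field K] [Algebra k K]
    (O : ValuationSubring K) (A : Subalgebra k K) (hk : ∀ c : k, algebraMap k K c ∈ O), A.FG →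
    IsFractionRing ↥A K → A.toSubring ≤ O.toSubring → ringKrullDim ↥A = 2 → O ≠ ⊤ →
    IsDiscreteValuationRing ↥O → residueTrdeg k O hk + 1 = Algebra.trdeg k K →
    ∀ m₁ : ℕ, HasRationalSingularity ↥(tower O A (m₁ + 1)) → ∃ m : ℕ, IsRegularLocalRing ↥(tower O A m) :=
  fun p hp k K _ _ _ _ O A hk hA hfr hAO hdim _ _ _ m₁ hrat =>
    rationalStageTermination hF p hp k K O A hk hA hfr hAO hdim m₁ hrat

/-- **`SurfaceTermination` for integrally closed `A` with a rational singularity at the centre of `O`**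
(res-L0-w44-stub-1's `hasRationalSingularity_tower_one` + the theorem): if `A` is normal and the birth stage
`T₀ = loc O A` has a rational singularity, the canonical `ca`-tower along `O` reaches a regular local ring —
modulo the six facts. [cite: Lipman1969, Proposition (1.2) (p. 199)] -/
theorem surfaceTermination_of_hasRationalSingularity_zero
    (hF : (CossartJannsenSaito2020General.{0} ∧ Lipman1969_1_2.{0} ∧ Lipman1969_4_1.{0} ∧
      Lipman1969_12_1_i.{0} ∧ Lipman1969_12_1_ii.{0} ∧
      Literature.AlgebraicGeometry.Morphisms.GortzWedhorn2023_24_44_H2.{0}))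
    (p : ℕ) (hp : p.Prime) (k K : Type) [Field k] [CharP k p] [Field K] [Algebra k K]
    (O : ValuationSubring K) (A : Subalgebra k K) (hk : ∀ c : k, algebraMap k K c ∈ O) (hA : A.FG)
    (hfr : IsFractionRing ↥A K) (hAO : A.toSubring ≤ O.toSubring) (hdimA : ringKrullDim ↥A = 2)
    [IsIntegrallyClosed ↥A] (hrat₀ : HasRationalSingularity ↥(tower O A 0)) :
    ∃ m : ℕ, IsRegularLocalRing ↥(tower O A m) :=
  rationalStageTermination hF p hp k K O A hk hA hfr hAO hdimA 0
    (RationalDescent.hasRationalSingularity_tower_one hF.2.1 O A hk hA hfr hAO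
      (trdeg_eq_two_of_ringKrullDim A hA hfr hdimA) hrat₀)

end Summit.ResolutionOfSingularities.ResolutionOfSingularities.Theorems.SurfaceTermination.Descent

end
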